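import Summits.RiemannHypothesis.RiemannHypothesis.Theorems.ThetaTier1Closed
import Summits.RiemannHypothesis.RiemannHypothesis.Theorems.WeilColumnThetaWitness
import HarnessLib

/-!
# THETA tier-1 — the BRIDGE from the kernel's real certificate to the analytic interface `ThetaParams`, part 1
(THETA-ASSIGN (AR); cc-s2-1, WEIL typing lane; RH-FREE bookkeeping)

`ThetaTier1Arith.checkAll_sound` turns a kernel verdict into `r.RealCert` (side conditions + `r.loss < r.gain`, registers of
the D1–D9 program with the STAND-IN constants `zetaHi`, `pLamHi`, `GAMMA_LO` and the exact Irwin–Hall polynomial `IH`).  The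
analytic programme (cc-s2-3's THETA-ASSIGN, interface `WeilColumn.ThetaMellin.ThetaParams`, p418783) consumes
`P.Admissible qn ∧ P.loss t₀ < P.gain J` for `P = ofRow r := ⟨q, m, δ, 1/20, 1/4, 3/5, 1⟩`, `t₀ = 2^{-k}`, `J = 16`, where
`P.loss`/`P.gain` carry the TRUE constants (`zetaTail`, `vonMangoldtSum`, `γ`) and the B-spline CDF (`P.chiL`, `P.Rtop`).
This file: `ofRow`, the four named hypotheses `ZetaHyp`/`LambdaHyp`/`ChiHyp`/`RtopHyp`, and `loss_le : P.loss (2^{-k}) ≤ r.loss`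
(with `u₁ = e^{η-δ}/√q`, `ζ⋆ = 4πδq e^{2δ-η}`, `Jexplicit (2^{-k}) =` register 32, `γ ≥ 1/2` from Mathlib, and the monotonicity
of every closed form in the constants proved here); part 2 (`ThetaTier1BridgeMain.lean`) adds the gain side, admissibility and
the main theorem `loss_lt_gain_of_realCert`.  Nothing here bears on the truth of RH.
-/

set_option linter.dupNamespace false  -- the mandated namespace repeats `RiemannHypothesis`
set_option autoImplicit false

namespace Summit.RiemannHypothesis.RiemannHypothesis.Theorems.ThetaTier1

open Literature.Analysis.ValidatedNumerics
open Summit.RiemannHypothesis.RiemannHypothesis.Theorems.WeilColumn.ThetaMellin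

noncomputable section

/-- The analytic parameters of a kernel row: `⟨q, m, δ, η = 1/20, c₁ = 1/4, m₀ = 3/5, c₂ = 1⟩`. [this cell, THETA-ASSIGN  2] -/
def ofRow (r : Row) : ThetaParams := ⟨r.q, r.m, (r.delta : ℝ), 1 / 20, 1 / 4, 3 / 5, 1⟩

/-- The `ζ` stand-ins dominate the true tails: `Σ_{n≥1} n^{-(m+1)} ≤ zetaHi (m+1)` and `Σ n^{-m} ≤ zetaHi m`. [this cell] -/
def ZetaHyp (m : ℕ) : Prop :=
  ThetaParams.zetaTail (m + 1) ≤ ((zetaHi (m + 1) : ℚ) : ℝ) ∧ ThetaParams.zetaTail m ≤ ((zetaHi m : ℚ) : ℝ)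

/-- The `Λ` stand-in dominates the true prime-power sum: `Σ Λ(n) n^{-(m+1)} ≤ pLamHi (m+1)`. [this cell] -/
def LambdaHyp (m : ℕ) : Prop := ThetaParams.vonMangoldtSum (m + 1) ≤ ((pLamHi (m + 1) : ℚ) : ℝ)

/-- The bottom-layer cut value is enclosed by the Irwin–Hall polynomial: `0 ≤ χ_L ≤ IH m (2mδ/η)`. [this cell] -/
def ChiHyp (r : Row) : Prop := 0 ≤ (ofRow r).chiL ∧ (ofRow r).chiL ≤ ((r.chiL : ℚ) : ℝ)

/-- The top-layer profile IS the Irwin–Hall polynomial at rational points: `R(τ) = IH m (mτ/2)`. [this cell] -/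
def RtopHyp (r : Row) : Prop := ∀ τ : ℚ, (ofRow r).Rtop (τ : ℝ) = ((Rtop r.m τ : ℚ) : ℝ)

variable (r : Row)

/-- `ofRow_q` (bridge bookkeeping). [this cell] -/
@[simp] theorem ofRow_q : (ofRow r).q = r.q := rfl
/-- `ofRow_m` (bridge bookkeeping). [this cell] -/
@[simp] theorem ofRow_m : (ofRow r).m = r.m := rfl
/-- `ofRow_δ` (bridge bookkeeping). [this cell] -/
@[simp] theorem ofRow_δ : (ofRow r).δ = (r.delta : ℝ) := rfl
/-- `ofRow_η` (bridge bookkeeping). [this cell] -/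
@[simp] theorem ofRow_η : (ofRow r).η = 1 / 20 := rfl
/-- `ofRow_c₁` (bridge bookkeeping). [this cell] -/
@[simp] theorem ofRow_c₁ : (ofRow r).c₁ = 1 / 4 := rfl
/-- `ofRow_m₀` (bridge bookkeeping). [this cell] -/
@[simp] theorem ofRow_m₀ : (ofRow r).m₀ = 3 / 5 := rfl
/-- `ofRow_c₂` (bridge bookkeeping). [this cell] -/
@[simp] theorem ofRow_c₂ : (ofRow r).c₂ = 1 := rfl

section Bridge
variable {r}

/-- `q_pos` (bridge bookkeeping). [this cell] -/
private theorem q_pos (hq : 2 ≤ r.q) : (0 : ℝ) < r.q := by exact_mod_cast (by omega : 0 < r.q)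

/-- `delta_pos` (bridge bookkeeping). [this cell] -/
private theorem delta_pos (hc : r.RealCert) : (0 : ℝ) < r.delta := by exact_mod_cast hc.2.2.2.1

/-- `two_delta_lt` (bridge bookkeeping). [this cell] -/
private theorem two_delta_lt (hc : r.RealCert) : 2 * (r.delta : ℝ) < 7 / 80 := by
  have h' : ((2 * r.delta : ℚ) : ℝ) < ((7 / 80 : ℚ) : ℝ) := Rat.cast_lt.2 hc.2.2.2.2.1
  push_cast at h'
  exact h' 

/-- `sqrt_pos` (bridge bookkeeping). [this cell] -/
private theorem sqrt_pos (hq : 2 ≤ r.q) : 0 < Real.sqrt r.q := Real.sqrt_pos.2 (q_pos hq)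

/-- `log_nonneg` (bridge bookkeeping). [this cell] -/
private theorem log_nonneg (hq : 2 ≤ r.q) : 0 ≤ Real.log r.q := Real.log_nonneg (by exact_mod_cast (by omega : 1 ≤ r.q))

/-- `exp_a` (bridge bookkeeping). [this cell] -/
private theorem exp_a (hq : 2 ≤ r.q) : Real.exp (ofRow r).a = Real.sqrt r.q * Real.exp r.delta := by
  have h0 : (0 : ℝ) ≤ r.q := (q_pos hq).le
  simp only [ThetaParams.a, ofRow_q, ofRow_δ]
  rw [Real.exp_add, ← Real.log_sqrt h0, Real.exp_log (sqrt_pos hq)]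

/-- `eps_eq` (bridge bookkeeping). [this cell] -/
private theorem eps_eq : (ofRow r).ε = 2 * r.delta := by simp [ThetaParams.ε]

/-- `alpha_eq` (bridge bookkeeping). [this cell] -/
private theorem alpha_eq : (ofRow r).α = ((r.alpha : ℚ) : ℝ) := by
  simp only [ThetaParams.α, eps_eq , ofRow_c₂, ofRow_m₀, ofRow_c₁, Row.alpha, Row.eps]
  push_cast; ring

/-- `alpha_pos` (bridge bookkeeping). [this cell] -/
private theorem alpha_pos (hc : r.RealCert) : 0 < (ofRow r).α := by
  simp only [ThetaParams.α, eps_eq , ofRow_c₂, ofRow_m₀, ofRow_c₁]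
  have := two_delta_lt hc
  apply div_pos <;> linarith

/-- `csum_eq` (bridge bookkeeping). [this cell] -/
private theorem csum_eq : (ofRow r).csum = ((r.csum : ℚ) : ℝ) := by
  simp only [ThetaParams.csum, alpha_eq , Row.csum]; push_cast; ring

/-- `csum_pos` (bridge bookkeeping). [this cell] -/
private theorem csum_pos (hc : r.RealCert) : 0 < (ofRow r).csum := by
  have := alpha_pos hc; simp only [ThetaParams.csum]; linarith

/-- `hmax_eq` (bridge bookkeeping). [this cell] -/
private theorem hmax_eq : (ofRow r).hmax = ((r.hmax : ℚ) : ℝ) := by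
  simp only [ThetaParams.hmax, alpha_eq , Row.hmax]; push_cast; rfl

/-- `u₁ = e^{η-δ}/√q` = register 21. -/
private theorem u1_eq (hq : 2 ≤ r.q) : (ofRow r).u₁ = r.env 21 := by
  obtain ⟨-, -, -, -, -, -, -, -, -, -, -, -, -, -, -, h15, -, -, -, -, h20⟩ := r.vals_table
  rw [r.env_21, h15, h20]
  simp only [ThetaParams.u₁, ThetaParams.x₁, ofRow_η]
  have hs := sqrt_pos hq
  have : (((ETA - r.delta : ℚ)) : ℝ) = 1 / 20 - (r.delta : ℝ) := by push_cast [ETA]; ring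
  rw [Real.exp_sub, exp_a hq, this, Real.exp_sub]
  field_simp

/-- `u1_pos` (bridge bookkeeping). [this cell] -/
private theorem u1_pos : 0 < (ofRow r).u₁ := Real.exp_pos _

/-- `ζ⋆ = 4πδq e^{2δ-η}` = register 22. -/
private theorem zstar_eq (hq : 2 ≤ r.q) : (ofRow r).zstar = r.env 22 := by
  obtain ⟨-, -, -, -, -, -, -, -, -, -, h10, -, -, -, h14, -, -, -, -, -, -⟩ := r.vals_table
  rw [r.env_22, h10, h14]
  simp only [ThetaParams.zstar, ThetaParams.lam, ThetaParams.u₁, ThetaParams.x₁, eps_eq , ofRow_c₂, ofRow_η, div_one]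
  have hs := sqrt_pos hq
  have e1 : Real.exp (1 / 20 - (ofRow r).a) = Real.exp (1 / 20) / Real.exp (ofRow r).a := Real.exp_sub _ _
  rw [e1, exp_a hq]
  have : (((2 * r.delta - ETA : ℚ)) : ℝ) = 2 * (r.delta : ℝ) - 1 / 20 := by push_cast [ETA]; ring
  rw [this, Real.exp_sub, show (2 : ℝ) * r.delta = r.delta + r.delta by ring, Real.exp_add]
  have hq0 : (0 : ℝ) ≤ r.q := (q_pos hq).le
  have hss : Real.sqrt r.q * Real.sqrt r.q = r.q := Real.mul_self_sqrt hq0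
  have he : Real.exp (1 / 20 : ℝ) ≠ 0 := (Real.exp_pos _).ne'
  push_cast
  conv_rhs => rw [← hss]
  field_simp
  ring

/-- `zstar_pos` (bridge bookkeeping). [this cell] -/
private theorem zstar_pos (hq : 2 ≤ r.q) (hc : r.RealCert) : 0 < (ofRow r).zstar := by
  rw [zstar_eq hq, r.env_22]
  obtain ⟨-, -, -, -, -, -, -, -, -, -, h10, -, -, -, h14, -, -, -, -, -, -⟩ := r.vals_table
  rw [h10, h14]
  have hd := delta_pos hc
  have hq' := q_pos hq
  have : (0 : ℝ) < ((4 * r.delta * r.q : ℚ) : ℝ) := by push_cast; positivity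
  exact mul_pos this (mul_pos Real.pi_pos (Real.exp_pos _))

/-- `(m/ζ⋆)^m` = register 24, `m/ζ⋆` = register 23. -/
private theorem mz_eq (hq : 2 ≤ r.q) : ((ofRow r).m : ℝ) / (ofRow r).zstar = r.env 23 := by
  rw [r.env_23, zstar_eq hq, div_eq_mul_inv, ofRow_m, Rat.cast_natCast]

/-- `mzm_eq` (bridge bookkeeping). [this cell] -/
private theorem mzm_eq (hq : 2 ≤ r.q) : (((ofRow r).m : ℝ) / (ofRow r).zstar) ^ (ofRow r).m = r.env 24 := by
  rw [r.env_24, ← mz_eq hq]; rfl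

/-- `mz_nonneg` (bridge bookkeeping). [this cell] -/
private theorem mz_nonneg (hq : 2 ≤ r.q) (hc : r.RealCert) : 0 ≤ r.env 23 := by
  rw [← mz_eq hq]; exact div_nonneg (Nat.cast_nonneg _) (zstar_pos hq hc).le

/-- `zetaTail_nonneg` (bridge bookkeeping). [this cell] -/
private theorem zetaTail_nonneg (s : ℕ) : 0 ≤ ThetaParams.zetaTail s :=
  tsum_nonneg fun n => by positivity

/-- `vonMangoldtSum_nonneg` (bridge bookkeeping). [this cell] -/
private theorem vonMangoldtSum_nonneg (s : ℕ) : 0 ≤ ThetaParams.vonMangoldtSum s :=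
  tsum_nonneg fun n => div_nonneg ArithmeticFunction.vonMangoldt_nonneg (by positivity)

/-! ## The closed forms, one register at a time -/

/-- D1: `0 ≤ M ≤` register 25. -/
private theorem M_le (hq : 2 ≤ r.q) (hc : r.RealCert) (hZ : ZetaHyp r.m) : 0 ≤ (ofRow r).M ∧ (ofRow r).M ≤ r.env 25 := by
  obtain ⟨-, -, -, -, -, -, -, -, -, -, h10, -⟩ := r.vals_table
  have hcs := (csum_pos hc).le
  have hX : 0 ≤ r.env 24 := by rw [r.env_24]; exact pow_nonneg (mz_nonneg hq hc) _
  have eM : (ofRow r).M = (ofRow r).csum * Real.pi⁻¹ * ThetaParams.zetaTail (r.m + 1) * r.env 24 := by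
    simp only [ThetaParams.M, ← mzm_eq hq, ofRow_m, div_eq_mul_inv]
  have e25 : r.env 25 = (ofRow r).csum * Real.pi⁻¹ * ((zetaHi (r.m + 1) : ℚ) : ℝ) * r.env 24 := by
    rw [r.env_25, h10, csum_eq ]
  rw [eM, e25]
  have hpi : 0 ≤ Real.pi⁻¹ := inv_nonneg.2 Real.pi_pos.le
  refine ⟨by have := zetaTail_nonneg (r.m + 1); positivity, ?_⟩
  gcongr
  exact hZ.1

/-- D2: `0 ≤ M₁ ≤` register 26. -/
private theorem M1_le (hq : 2 ≤ r.q) (hc : r.RealCert) (hZ : ZetaHyp r.m) : 0 ≤ (ofRow r).M₁ ∧ (ofRow r).M₁ ≤ r.env 26 := by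
  obtain ⟨-, -, -, -, -, -, -, -, -, -, -, -, -, -, h14, -⟩ := r.vals_table
  have hcs := (csum_pos hc).le
  have hX : 0 ≤ r.env 24 := by rw [r.env_24]; exact pow_nonneg (mz_nonneg hq hc) _
  have h23 := mz_nonneg hq hc
  have hd := (delta_pos hc).le
  have hlu : (ofRow r).lam / (ofRow r).u₁ = r.q * r.vals 14 := by
    rw [h14]
    simp only [ThetaParams.lam, ThetaParams.u₁, ThetaParams.x₁, ofRow_c₂, ofRow_η, div_one]
    have : (((2 * r.delta - ETA : ℚ)) : ℝ) = 2 * (r.delta : ℝ) - 1 / 20 := by push_cast [ETA]; ring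
    rw [this, div_eq_iff (Real.exp_pos _).ne', ← Real.exp_log (q_pos hq), ← Real.exp_add, ← Real.exp_add]
    congr 1
    simp only [ThetaParams.a, ofRow_q, ofRow_δ]
    ring
  have eM1 : (ofRow r).M₁ = 2 * (r.q * r.vals 14) * (ofRow r).csum * (1 + 2 * (r.delta : ℝ) * (1 + r.env 23)) *
      ThetaParams.zetaTail r.m * r.env 24 := by
    simp only [ThetaParams.M₁, hlu, ← mzm_eq hq, ← mz_eq hq, eps_eq, ofRow_c₂, ofRow_m]
  have e26 : r.env 26 = 2 * (r.q * r.vals 14) * (ofRow r).csum * (1 + 2 * (r.delta : ℝ) * (1 + r.env 23)) *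
      ((zetaHi r.m : ℚ) : ℝ) * r.env 24 := by
    rw [r.env_26, csum_eq , Row.eps]; push_cast; ring
  have h14' : 0 ≤ r.vals 14 := by rw [h14]; exact (Real.exp_pos _).le
  rw [eM1, e26]
  refine ⟨by have := zetaTail_nonneg r.m; positivity, ?_⟩
  gcongr
  exact hZ.2

/-- D3: `0 ≤ A ≤` register 27. -/
private theorem A_le (hq : 2 ≤ r.q) (hc : r.RealCert) (hZ : ZetaHyp r.m) : 0 ≤ (ofRow r).A ∧ (ofRow r).A ≤ r.env 27 := by
  obtain ⟨hM0, hM⟩ := M_le hq hc hZ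
  have hu := (u1_pos (r := r)).le
  have eA : (ofRow r).A = 2 / (2 * (r.m : ℝ) + 1) * (ofRow r).M ^ 2 * (ofRow r).u₁ := by
    simp only [ThetaParams.A, ofRow_m]; ring
  have e27 : r.env 27 = 2 / (2 * (r.m : ℝ) + 1) * r.env 25 ^ 2 * (ofRow r).u₁ := by
    rw [r.env_27, u1_eq hq]; push_cast; ring
  rw [eA, e27]
  exact ⟨by positivity, by gcongr⟩

/-- D3: `0 ≤ ‖T′‖₂⁺ ≤` register 28. -/
private theorem Bin_le (hq : 2 ≤ r.q) (hc : r.RealCert) (hZ : ZetaHyp r.m) : 0 ≤ (ofRow r).Bin ∧ (ofRow r).Bin ≤ r.env 28 := by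
  obtain ⟨hM0, hM⟩ := M_le hq hc hZ
  obtain ⟨hM10, hM1⟩ := M1_le hq hc hZ
  have hu := (u1_pos (r := r)).le
  have eB : (ofRow r).Bin = (1 / 2 + (r.m : ℝ) / (1 / 20)) * (ofRow r).M * Real.sqrt ((ofRow r).u₁ * (1 / (2 * (r.m : ℝ) + 1))) +
      (ofRow r).M₁ * Real.sqrt ((ofRow r).u₁ * (1 / (2 * (r.m : ℝ) - 1))) := by
    simp only [ThetaParams.Bin, ofRow_m, ofRow_η, div_eq_mul_one_div ((ofRow r).u₁)]
  have e28 : r.env 28 = (1 / 2 + (r.m : ℝ) / (1 / 20)) * r.env 25 * Real.sqrt ((ofRow r).u₁ * (1 / (2 * (r.m : ℝ) + 1))) +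
      r.env 26 * Real.sqrt ((ofRow r).u₁ * (1 / (2 * (r.m : ℝ) - 1))) := by
    rw [r.env_28, u1_eq hq]; push_cast [ETA]; ring
  rw [eB, e28]
  exact ⟨by positivity, by gcongr⟩

/-- D3: `0 ≤ B ≤` register 29. -/
private theorem B_le (hq : 2 ≤ r.q) (hc : r.RealCert) (hZ : ZetaHyp r.m) : 0 ≤ (ofRow r).B ∧ (ofRow r).B ≤ r.env 29 := by
  obtain ⟨hB0, hB⟩ := Bin_le hq hc hZ
  rw [r.env_29]
  simp only [ThetaParams.B]
  exact ⟨by positivity, by gcongr⟩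

/-- D6: `primesC ≤` register 30. -/
private theorem primesC_le (hq : 2 ≤ r.q) (hc : r.RealCert) (hZ : ZetaHyp r.m) (hΛ : LambdaHyp r.m) : (ofRow r).primesC ≤ r.env 30 := by
  obtain ⟨hM0, hM⟩ := M_le hq hc hZ
  have hu := (u1_pos (r := r)).le
  have hL := vonMangoldtSum_nonneg (r.m + 1)
  have eP : (ofRow r).primesC = 4 / (2 * (r.m : ℝ) + 1) * ThetaParams.vonMangoldtSum (r.m + 1) * (ofRow r).M ^ 2 * (ofRow r).u₁ := by
    simp only [ThetaParams.primesC, ofRow_m]; ring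
  have e30 : r.env 30 = 4 / (2 * (r.m : ℝ) + 1) * ((pLamHi (r.m + 1) : ℚ) : ℝ) * r.env 25 ^ 2 * (ofRow r).u₁ := by
    rw [r.env_30, u1_eq hq]; push_cast; ring
  have hP : 0 ≤ ((pLamHi (r.m + 1) : ℚ) : ℝ) := by simp only [pLamHi]; positivity
  have hΛ' : ThetaParams.vonMangoldtSum (r.m + 1) ≤ ((pLamHi (r.m + 1) : ℚ) : ℝ) := hΛ
  rw [eP, e30]
  gcongr

/-- D6: `cross ≤` register 31. -/
private theorem cross_le (hq : 2 ≤ r.q) (hc : r.RealCert) (hZ : ZetaHyp r.m) : (ofRow r).cross ≤ r.env 31 := by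
  obtain ⟨hM0, hM⟩ := M_le hq hc hZ
  obtain ⟨-, -, -, -, -, -, -, -, -, -, -, -, -, -, -, -, h16, -⟩ := r.vals_table
  have e16 : r.vals 16 = Real.exp (-(r.m : ℝ) / (r.m + 1)) := by rw [h16]; push_cast; ring_nf
  have eC : (ofRow r).cross = 2 * (103883 / 100000) * ((ofRow r).M ^ 2 *
      (1 / (r.m : ℝ) ^ 2 + Real.exp (-(r.m : ℝ) / (r.m + 1)) * (1 / ((r.m : ℝ) + 1)))) := by
    simp only [ThetaParams.cross, ThetaParams.rsConst, ofRow_m]; ring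
  have e31 : r.env 31 = 2 * (103883 / 100000) * (r.env 25 ^ 2 *
      (1 / (r.m : ℝ) ^ 2 + Real.exp (-(r.m : ℝ) / (r.m + 1)) * (1 / ((r.m : ℝ) + 1)))) := by
    rw [r.env_31, e16, RS]; push_cast; ring
  rw [eC, e31]
  have : 0 ≤ 1 / (r.m : ℝ) ^ 2 + Real.exp (-(r.m : ℝ) / (r.m + 1)) * (1 / ((r.m : ℝ) + 1)) := by positivity
  gcongr

/-- D7: `Jexplicit (2^{-k})` = register 32. -/
private theorem J_eq : ThetaParams.Jexplicit (1 / 2 ^ r.k) = r.env 32 := by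
  obtain ⟨h0, h1, h2, h3, h4, h5, h6, h7, h8, h9, -⟩ := r.vals_table
  rw [r.env_32, h0, h1, h2, h3, h4, h5, h6, h7, h8, h9]
  have hl : Real.log (1 / (1 / (2 : ℝ) ^ r.k)) = r.k * Real.log 2 := by rw [one_div_one_div, Real.log_pow]
  simp only [ThetaParams.Jexplicit, hl]
  have hne : (1 : ℝ) - Real.exp (-2) ≠ 0 := by
    have : Real.exp (-2) < 1 := Real.exp_lt_one_iff.2 (by norm_num)
    linarith
  push_cast
  field_simp
  ring

/-- D7: the clipped arch coefficient, `γ ≥ 1/2`: `(2J − log 4π − γ − C₁) ≤` register 33. -/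
private theorem archc_le : 2 * ThetaParams.Jexplicit (1 / 2 ^ r.k) - Real.log (4 * Real.pi) - Real.eulerMascheroniConstant -
    ThetaParams.archC₁ ≤ r.env 33 := by
  obtain ⟨-, -, -, -, -, -, -, -, -, h9, h10, h11, -⟩ := r.vals_table
  rw [r.env_33, ← J_eq , h9, h10, h11, GAMMA_LO]
  simp only [ThetaParams.archC₁]
  have hγ := Real.one_half_lt_eulerMascheroniConstant
  push_cast
  nlinarith [hγ]

/-- D7: `arch (2^{-k}) ≤` register 34. -/
private theorem arch_le (hq : 2 ≤ r.q) (hc : r.RealCert) (hZ : ZetaHyp r.m) : (ofRow r).arch (1 / 2 ^ r.k) ≤ r.env 34 := by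
  obtain ⟨hA0, hA⟩ := A_le hq hc hZ
  obtain ⟨hB0, hB⟩ := B_le hq hc hZ
  obtain ⟨-, -, -, -, -, -, -, -, -, -, -, -, -, -, -, -, -, h17, -⟩ := r.vals_table
  have e17 : r.vals 17 = Real.exp (1 / 2 ^ r.k / 2) := by rw [h17, Row.t0]; push_cast; ring_nf
  have hc33 := archc_le (r := r)
  have eAr : (ofRow r).arch (1 / 2 ^ r.k) = (ofRow r).B * Real.exp (1 / 2 ^ r.k / 2) * ((1 / 2 ^ r.k) ^ 2 / 4) +
      (ofRow r).A * max 0 (2 * ThetaParams.Jexplicit (1 / 2 ^ r.k) - Real.log (4 * Real.pi) -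
        Real.eulerMascheroniConstant - ThetaParams.archC₁) := by
    simp only [ThetaParams.arch]; ring
  have e34 : r.env 34 = r.env 29 * Real.exp (1 / 2 ^ r.k / 2) * ((1 / 2 ^ r.k) ^ 2 / 4) + r.env 27 * max 0 (r.env 33) := by
    rw [r.env_34, e17, Row.t0]; push_cast; ring
  rw [eAr, e34]
  have hmax : max 0 (2 * ThetaParams.Jexplicit (1 / 2 ^ r.k) - Real.log (4 * Real.pi) - Real.eulerMascheroniConstant -
      ThetaParams.archC₁) ≤ max 0 (r.env 33) := max_le_max le_rfl hc33
  have hm0 : 0 ≤ max 0 (2 * ThetaParams.Jexplicit (1 / 2 ^ r.k) - Real.log (4 * Real.pi) - Real.eulerMascheroniConstant -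
      ThetaParams.archC₁) := le_max_left _ _
  have hE : 0 ≤ Real.exp (1 / 2 ^ r.k / 2) := (Real.exp_pos _).le
  have hc0 : (0 : ℝ) ≤ (1 / 2 ^ r.k) ^ 2 / 4 := by positivity
  have h27 : 0 ≤ r.env 27 := hA0.trans hA
  exact add_le_add (mul_le_mul_of_nonneg_right (mul_le_mul_of_nonneg_right hB hE) hc0) (mul_le_mul hA hmax hm0 h27)

/-- D4: `0 ≤ M_L ≤` register 35. -/
private theorem ML_le (hq : 2 ≤ r.q) (hc : r.RealCert) (hZ : ZetaHyp r.m) : 0 ≤ (ofRow r).ML ∧ (ofRow r).ML ≤ r.env 35 := by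
  obtain ⟨hM0, hM⟩ := M_le hq hc hZ
  obtain ⟨-, -, -, -, -, -, -, -, -, -, -, -, -, -, -, -, -, -, h18, -⟩ := r.vals_table
  have e18 : r.vals 18 = Real.exp ((r.m : ℝ) * (2 * (r.delta : ℝ) - 1 / 20)) := by rw [h18]; push_cast [ETA]; ring_nf
  have eML : (ofRow r).ML = (ofRow r).M * Real.exp ((r.m : ℝ) * (2 * (r.delta : ℝ) - 1 / 20)) := by
    simp only [ThetaParams.ML, ofRow_m, ofRow_δ, ofRow_η]
  rw [r.env_35, e18, eML]
  exact ⟨by positivity, by gcongr⟩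

/-- D4: `rbar ≤` register 36 and `0 ≤ rbar`. -/
private theorem rbar_le (hq : 2 ≤ r.q) (hc : r.RealCert) (hZ : ZetaHyp r.m) (hχ : ChiHyp r) : 0 ≤ (ofRow r).rbar ∧ (ofRow r).rbar ≤ r.env 36 := by
  obtain ⟨hML0, hML⟩ := ML_le hq hc hZ
  obtain ⟨hχ0, hχ1⟩ := hχ
  obtain ⟨-, -, -, -, -, -, -, -, -, -, -, -, -, h13, -, -, -, -, -, -, h20⟩ := r.vals_table
  have hd := (delta_pos hc).le
  have hs := sqrt_pos hq
  have hh : 0 ≤ ((r.hmax : ℚ) : ℝ) := by rw [← hmax_eq ]; simp only [ThetaParams.hmax]; exact le_max_of_le_left zero_le_one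
  have eR : (ofRow r).rbar = 4 * (r.delta : ℝ) * ((r.hmax : ℚ) : ℝ) * (ofRow r).chiL * Real.exp r.delta * (ofRow r).ML +
      2 * (r.delta : ℝ) * (ofRow r).chiL ^ 2 * Real.exp r.delta * (Real.sqrt r.q)⁻¹ * (ofRow r).ML ^ 2 := by
    simp only [ThetaParams.rbar, hmax_eq , ofRow_δ, ofRow_q]; ring
  have e36 : r.env 36 = 4 * (r.delta : ℝ) * ((r.hmax : ℚ) : ℝ) * ((r.chiL : ℚ) : ℝ) * Real.exp r.delta * r.env 35 +
      2 * (r.delta : ℝ) * ((r.chiL : ℚ) : ℝ) ^ 2 * Real.exp r.delta * (Real.sqrt r.q)⁻¹ * r.env 35 ^ 2 := by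
    rw [r.env_36, h13, h20]; push_cast; ring
  rw [eR, e36]
  refine ⟨by positivity, ?_⟩
  have hsi : 0 ≤ (Real.sqrt r.q)⁻¹ := inv_nonneg.2 hs.le
  have hE : 0 ≤ Real.exp (r.delta : ℝ) := (Real.exp_pos _).le
  have h35 : 0 ≤ r.env 35 := hML0.trans hML
  have hχc : 0 ≤ ((r.chiL : ℚ) : ℝ) := hχ0.trans hχ1
  have t1 : 4 * (r.delta : ℝ) * ((r.hmax : ℚ) : ℝ) * (ofRow r).chiL * Real.exp r.delta * (ofRow r).ML ≤
      4 * (r.delta : ℝ) * ((r.hmax : ℚ) : ℝ) * ((r.chiL : ℚ) : ℝ) * Real.exp r.delta * r.env 35 := by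
    have h4 : 0 ≤ 4 * (r.delta : ℝ) * ((r.hmax : ℚ) : ℝ) := by positivity
    exact mul_le_mul (mul_le_mul_of_nonneg_right (mul_le_mul_of_nonneg_left hχ1 h4) hE) hML hML0 (by positivity)
  have t2 : 2 * (r.delta : ℝ) * (ofRow r).chiL ^ 2 * Real.exp r.delta * (Real.sqrt r.q)⁻¹ * (ofRow r).ML ^ 2 ≤
      2 * (r.delta : ℝ) * ((r.chiL : ℚ) : ℝ) ^ 2 * Real.exp r.delta * (Real.sqrt r.q)⁻¹ * r.env 35 ^ 2 := by
    have hsq1 : (ofRow r).chiL ^ 2 ≤ ((r.chiL : ℚ) : ℝ) ^ 2 := pow_le_pow_left₀ hχ0 hχ1 2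
    have hsq2 : (ofRow r).ML ^ 2 ≤ r.env 35 ^ 2 := pow_le_pow_left₀ hML0 hML 2
    have h2 : 0 ≤ 2 * (r.delta : ℝ) := by positivity
    exact mul_le_mul (mul_le_mul_of_nonneg_right (mul_le_mul_of_nonneg_right (mul_le_mul_of_nonneg_left hsq1 h2) hE) hsi)
      hsq2 (by positivity) (by positivity)
  exact add_le_add t1 t2

/-- D4: `atom ≤` register 37. -/
private theorem atom_le (hq : 2 ≤ r.q) (hc : r.RealCert) (hZ : ZetaHyp r.m) (hχ : ChiHyp r) : (ofRow r).atom ≤ r.env 37 := by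
  obtain ⟨hr0, hr⟩ := rbar_le hq hc hZ hχ
  obtain ⟨-, -, -, -, -, -, -, -, -, -, -, -, -, -, -, -, -, -, -, h19, h20⟩ := r.vals_table
  have hs := sqrt_pos hq
  have hl := log_nonneg hq
  have eA : (ofRow r).atom = 2 * Real.log r.q * (Real.sqrt r.q)⁻¹ * (ofRow r).rbar := by
    simp only [ThetaParams.atom, ofRow_q, div_eq_mul_inv]
  rw [r.env_37, h19, h20, eA]
  have hsi : 0 ≤ (Real.sqrt r.q)⁻¹ := inv_nonneg.2 hs.le
  gcongr

/-- D9: `P.loss (2^{-k}) ≤ r.loss`. -/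
theorem loss_le (hq : 2 ≤ r.q) (hc : r.RealCert) (hZ : ZetaHyp r.m) (hΛ : LambdaHyp r.m) (hχ : ChiHyp r) : (ofRow r).loss (1 / 2 ^ r.k) ≤ r.loss := by
  rw [r.loss_gain.1, r.env_38, ThetaParams.loss_eq]
  have h1 := primesC_le hq hc hZ hΛ
  have h2 := cross_le hq hc hZ
  have h3 := arch_le hq hc hZ
  have h4 := atom_le hq hc hZ hχ
  linarith

end Bridge

end

end Summit.RiemannHypothesis.RiemannHypothesis.Theorems.ThetaTier1
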